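import Summits.BirchSwinnertonDyer.Rank1Residual.X2.TwistTamagawa
import Literature.NumberTheory.Automorphic.ShimuraCurveRibetTakahashiOptimalProofs
import Literature.NumberTheory.EllipticCurves.ManinConstantSemistablePrimewise
import Literature.NumberTheory.EllipticCurves.ManinConstantIntegral
import Literature.NumberTheory.EllipticCurves.CuspFormLFunctionLevelConductorProofs
import Literature.NumberTheory.EllipticCurves.BSDRootNumberLocalTablesProofs
import HarnessLib

/-!
# Class X2, rank `1` (sub-cell X2c): the per-pair Manin condition DISCHARGED at class level —
# Mazur 1978 on the optimal curve + Cassels along the isogeny (cell `b2b-bsdres`, unit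
# `b2b-bsdres-eisenstein-p2`, gen 3)

HONEST FRAMING (run/shared/lean/b2b/bsd-rank1-residual/, verbatim in every file): the goal of the
cell is to DELETE the COMBINATION-SHAPED residual classes of the Birch–Swinnerton-Dyer formula for
ALL analytic-rank `≤ 1` elliptic curves over `ℚ` — "full BSD formula for every rank `≤ 1` curve in
class `C`" assembled STRICTLY from published theorems — so that the rank-`≤ 1` remainder becomes
exactly the CONSTRUCTION-SHAPED classes, which are TYPED (missing-input `Prop`s), NOT attempted.
This is not "finishing BSD". Research routes; no claim beyond stated classes. X2c stays
CONSTRUCTION-SHAPED. Theorems only (no definition, no named fact): every published theorem enters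
as an explicit hypothesis (the tree's existing NAMED FACTS) or as a tree theorem.

Gen 2's class-level chain for X2c (`X2/RankOneHeegnerClass.lean`) carried, besides the typed input
over `K` (`X2.HeegnerIndexIdentity`) and Mazur's main conjecture at the X2b partners, two binders:
the transport package — PROVED in gen 3 (`X2.twistTransportPackage_holds`, `X2/TwistTamagawa.lean`)
— and the PER-PAIR Manin condition `HasPrimeToManinDatum W p` ("`E` has a modular parametrisation
of level `N_E` with Manin constant prime to `p`"), which is NOT automatic for a non-optimal curve
at an Eisenstein prime. This file discharges it at CLASS level from PUBLISHED facts: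

| binder | fact (tree decl) | source | status |
|---|---|---|---|
| `hEd` | `edixhoven_optimalManinConstant_integral` | Edixhoven 1991 Prop. 2 = Agashe–Ribet–Stein 2006 Thm. 2.2 (the optimal Manin constant is an integer) | PUB |
| `hMaz` | `mazur_not_dvd_maninConstant_of_odd` | Mazur 1978 Cor. 4.1 (`p` odd, `p² ∤ N` ⇒ `p ∤ c` for the optimal curve) | PUB |
| `hCassels` | `WeierstrassCurve.bsdRHS_eq_of_isIsogenous` | Cassels 1965 / Milne ADT I.7.3 (isogeny invariance of the BSD quotient) | PUB |
| `hpar`, `hnf` | `nonempty_modularParametrizationData`, `exists_isNewformOf` | modularity (Wiles, BCDT) | PUB |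

* `exists_isIsogenous_hasPrimeToManinDatum` — for `W/ℚ` globally minimal and an odd prime `p` of
  multiplicative reduction there is a globally minimal `W₀`, `ℚ`-isogenous to `W`, with
  `HasPrimeToManinDatum W₀ p`: the minimal-degree (optimal) parametrisation of the isogeny class
  (`exists_optimal_modularParametrizationData_of_edixhoven`) has `Λ_{E₀} = c Λ_f`
  (`latticeEq_of_modularDegree_le` against the unconditional optimal datum `exists_optimalDatum'`),
  its level is `N_{E₀}` (strong multiplicity one from modularity,
  `IsNewformOf.level_eq_conductorNorm_of_exists_isNewformOf`), and `p² ∤ N` at a multiplicative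
  prime, so Mazur's Cor. 4.1 gives `p ∤ c`.
* `targetC_of_heegnerIndexIdentity_of_targetB` — **sub-cell X2c's target from the typed input over
  `K` and sub-cell X2b's target ALONE** (plus published facts): CellC is an isogeny-class
  condition (`CellC.of_isIsogenous`), `BSD(E₀,p)` by gen 2's chain with the Manin datum of `E₀` and
  gen 3's transport theorem, and `BSD(E,p)` by Cassels (`bsdp_of_isIsogenous_of_bsdp`).
* `target_of_published_of_missingInputB_of_heegnerIndexIdentity''` — **what remains of class X2 in
  the kernel: `X2.Target` ⇐ PUBLISHED facts + Mazur's main conjecture at every X2b pair (EXACT,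
  `X2/RankZeroExact.lean`) + the Heegner-index identity over `K` at `p ‖ N` (typed; Keller–Yin PRE
  + located links, `X2/RankOneLinks.lean`).** No per-pair binder is left.

References: [Mazur1978] Cor. 4.1; [EdixhovenManin1991] Prop. 2; [AgasheRibetStein2006] Thm. 2.2,
2.6; [Cassels1965ArithmeticVIII]; [MilneADT2006] I.7.3; [Knapp1993] Thm. 11.74; [AtkinLehner1970]
Thm. 4; [CastellaEtAl2021] Thm. 5.3.1 (assembly shape); [Miller2011LMS] Def. 1.1.
-/

set_option autoImplicit false

noncomputable section

open scoped Classical MatrixGroups ModularForm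

open CongruenceSubgroup IsDedekindDomain NumberField Rat.HeightOneSpectrum WeierstrassCurve
  Literature.NumberTheory.EllipticCurves Literature.NumberTheory.EllipticCurves.ModularForms
  Literature.NumberTheory.QuadraticFields Literature.NumberTheory.EllipticCurves.Rank1Residual
  Literature.NumberTheory.EllipticCurves.Rank1Residual.Typed
  Literature.NumberTheory.EllipticCurves.GreenbergVatsal2000
  Literature.NumberTheory.EllipticCurves.Wuthrich2014
  Literature.NumberTheory.EllipticCurves.SteinWuthrich2013

namespace Summit.BirchSwinnertonDyer.Rank1Residual.X2

/-! ### The optimal curve of the isogeny class has a Manin datum prime to `p` -/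

/-- Transport of a datum along an equality of levels, keeping the Manin constant. [folklore] -/
private theorem exists_datum_of_level_eq {W : WeierstrassCurve ℚ} {N M : ℕ} [NeZero N] [NeZero M]
    (h : N = M) (D : ModularParametrizationData W N) :
    ∃ D' : ModularParametrizationData W M, D'.c = D.c := by
  subst h
  exact ⟨D, rfl⟩

/-- `p² ∤ N_E` at a prime `p` of multiplicative reduction (`f_p = 1`; Silverman *ATAEC* IV.10.2).
[cite: SilvermanATAEC1994, IV.10.2(b)] -/
theorem not_sq_dvd_conductorNorm_of_mult (W : WeierstrassCurve ℚ) [W.IsElliptic] (p : ℕ)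
    [Fact p.Prime] (hmult : W.HasMultiplicativeReductionAtPrime p) :
    ¬ p ^ 2 ∣ W.conductorNorm ℤ := by
  have hp : p.Prime := Fact.out
  set v : HeightOneSpectrum ℤ := (primesEquiv (R := ℤ)).symm ⟨p, hp⟩ with hv
  have hgen : natGenerator v = p := congrArg Subtype.val ((primesEquiv (R := ℤ)).apply_symm_apply ⟨p, hp⟩)
  have hmv : W.HasMultiplicativeReductionAt v :=
    (WeierstrassCurve.hasMultiplicativeReductionAtPrime_iff_hasMultiplicativeReductionAt_holds W
      ⟨p, hp⟩).mp hmult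
  intro hsq
  rw [← hgen] at hsq
  exact hmv.not_hasAdditiveReductionAt ((natGenerator_sq_dvd_conductorNorm_iff v W).mp hsq)

/-- **The optimal curve of the isogeny class carries a Manin datum prime to `p`.** For `W/ℚ`
globally minimal elliptic and an odd prime `p` of multiplicative reduction, granted Edixhoven's
integrality (`hEd`), Mazur's Cor. 4.1 (`hMaz`) and modularity (`hpar`, `hnf`): some globally
minimal `W₀`, `ℚ`-isogenous to `W`, has `HasPrimeToManinDatum W₀ p`. Proof: the minimal-degree
parametrisation `D₀` of the class lives on a globally minimal `W₀ ∼ W`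
(`exists_optimal_modularParametrizationData_of_edixhoven`); it is lattice-optimal
(`latticeEq_of_modularDegree_le` against `exists_optimalDatum'`), so Mazur's Cor. 4.1 applies at
the odd `p` with `p² ∤ N` (`not_sq_dvd_conductorNorm_of_mult`); its level `N_E` is `N_{E₀}` by
strong multiplicity one (`IsNewformOf.level_eq_conductorNorm_of_exists_isNewformOf`).
[cite: Mazur1978, Cor. 4.1] [cite: EdixhovenManin1991, Prop. 2] [cite: AgasheRibetStein2006, Thm. 2.2 and 2.6]
[cite: Knapp1993, Thm. 11.74 (c)(d)] -/
theorem exists_isIsogenous_hasPrimeToManinDatum (hEd : edixhoven_optimalManinConstant_integral)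
    (hMaz : mazur_not_dvd_maninConstant_of_odd) (hpar : nonempty_modularParametrizationData)
    (hnf : exists_isNewformOf)
    (W : WeierstrassCurve ℚ) [W.IsElliptic] [W.IsGloballyMinimal] (p : ℕ) [Fact p.Prime]
    (hp2 : p ≠ 2) (hmult : W.HasMultiplicativeReductionAtPrime p) :
    ∃ (W₀ : WeierstrassCurve ℚ) (_ : W₀.IsElliptic) (_ : W₀.IsGloballyMinimal),
      W.IsIsogenous W₀ ∧ HasPrimeToManinDatum W₀ p := by
  have hp : p.Prime := Fact.out
  haveI : NeZero (W.conductorNorm ℤ) := ⟨(W.conductorNorm_pos_holds).ne'⟩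
  obtain ⟨W₀, hE₀, hM₀, D₀, -, hiso, hmin⟩ :=
    Literature.NumberTheory.Automorphic.exists_optimal_modularParametrizationData_of_edixhoven hEd
      (W.conductorNorm ℤ) W rfl (hpar W)
  haveI := hE₀
  haveI := hM₀
  refine ⟨W₀, hE₀, hM₀, hiso, ?_⟩
  -- `D₀` is lattice-optimal: compare with the unconditional optimal datum of the same newform
  obtain ⟨W₁, hE₁, D₁, hf₁, hlat₁⟩ := D₀.exists_optimalDatum'
  haveI := hE₁
  have hlat₀ : ∀ z ∈ D₀.L.lattice, ∃ w ∈ periodLattice D₀.f, z = D₀.c * w :=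
    D₀.latticeEq_of_modularDegree_le D₁ hf₁ hlat₁ (hmin W₁ D₁ hf₁)
  -- Mazur's Cor. 4.1 at the odd prime `p ∥ N`
  have hsq : ¬ p ^ 2 ∣ W.conductorNorm ℤ := not_sq_dvd_conductorNorm_of_mult W p hmult
  have hc : ¬ (p : ℤ) ∣ D₀.c := hMaz W₀ D₀ hlat₀ p hp hp2 hsq
  -- the level is the conductor of `W₀`
  have hN : W.conductorNorm ℤ = W₀.conductorNorm ℤ :=
    IsNewformOf.level_eq_conductorNorm_of_exists_isNewformOf hnf D₀.isNewformOf
  intro _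
  obtain ⟨D', hD'⟩ := exists_datum_of_level_eq hN D₀
  exact ⟨D', by rw [hD']; exact hc⟩

/-! ### Sub-cell X2c without the per-pair Manin binder -/

/-- **X2c ⇒ `BSD(E,p)` at a pair, the Manin condition moved to the optimal curve**: if `BSD(·,p)`
holds at every globally minimal `W₀ ∼ W` of the class that is CellC and carries a Manin datum prime
to `p`, then `BSD(E,p)` (CellC is an isogeny-class condition, `CellC.of_isIsogenous`; the optimal
curve qualifies, `exists_isIsogenous_hasPrimeToManinDatum`; Cassels brings `BSD` back,
`bsdp_of_isIsogenous_of_bsdp`). [cite: MilneADT2006, Thm. I.7.3] [cite: Mazur1978, Cor. 4.1] -/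
theorem bsdp_of_cellC_of_forall_isIsogenous (hEd : edixhoven_optimalManinConstant_integral)
    (hMaz : mazur_not_dvd_maninConstant_of_odd) (hCassels : bsdRHS_eq_of_isIsogenous)
    (hpar : nonempty_modularParametrizationData) (hnf : exists_isNewformOf)
    (hGZK : rank_eq_analyticRank_of_analyticRank_le_one)
    (W : WeierstrassCurve ℚ) [W.IsElliptic] [W.IsGloballyMinimal] (p : ℕ) [Fact p.Prime]
    (hc : CellC W p)
    (h : ∀ (W₀ : WeierstrassCurve ℚ) [W₀.IsElliptic] [W₀.IsGloballyMinimal],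
      W.IsIsogenous W₀ → CellC W₀ p → HasPrimeToManinDatum W₀ p → BSDp W₀ p) : BSDp W p := by
  obtain ⟨W₀, hE₀, hM₀, hiso, hMan⟩ :=
    exists_isIsogenous_hasPrimeToManinDatum hEd hMaz hpar hnf W p hc.2.1 hc.2.2.2
  haveI := hE₀
  haveI := hM₀
  have hc₀ : CellC W₀ p := CellC.of_isIsogenous hiso hc
  have h₀ : BSDp W₀ p := h W₀ hiso hc₀ hMan
  exact bsdp_of_isIsogenous_of_bsdp hCassels hGZK
    (WeierstrassCurve.hasEntireLFunction_rat_of_exists_isNewformOf hnf) W₀ W hiso.symm_of_charZero p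
    (by rw [hc₀.1]) h₀

/-- **Sub-cell X2c's target from the typed input over `K` and sub-cell X2b's target** (published
facts otherwise; NO per-pair binder): gen 2's `targetC_of_heegnerIndexIdentity_of_manin_of_targetB`
with the transport package proved (gen 3, `twistTransportPackage_holds`) and the Manin condition
discharged on the optimal curve of each class (`bsdp_of_cellC_of_forall_isIsogenous`).
[cite: CastellaEtAl2021, Thm. 5.3.1] [cite: Mazur1978, Cor. 4.1] [cite: Miller2011LMS, Def. 1.1] -/
theorem targetC_of_heegnerIndexIdentity_of_targetB
    (hGV : lambdaMu_multiplicative_of_gvPar) (hWu : thm16_charIdeal_dvd_multiplicative_of_reducible)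
    (hJs : thm61_splitMultiplicative) (hJn : thm61_nonsplitMultiplicative)
    (hHs : exists_isSplitMultCanonical) (hHn : exists_isMultCanonical)
    (hpar : nonempty_modularParametrizationData)
    (hGS : ∀ (W : WeierstrassCurve ℚ) [W.IsElliptic] [W.IsGloballyMinimal] (p : ℕ) [Fact p.Prime],
      greenberg_stevens (W := W) (p := p))
    (hGZ : ∀ (N : ℕ) [NeZero N] (W : WeierstrassCurve ℚ) (K : Type) [Field K] [NumberField K],
      gross_zagier N W K)
    (hKo : ∀ (N : ℕ) [NeZero N] (W : WeierstrassCurve ℚ) (K : Type) [Field K] [NumberField K],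
      kolyvagin N W K)
    (hHP : ∀ (N : ℕ) [NeZero N] (W : WeierstrassCurve ℚ) (K : Type) [Field K] [NumberField K],
      heegnerPointComplex_mem_range_map N W K)
    (hGZK : rank_eq_analyticRank_of_analyticRank_le_one) (hnf : exists_isNewformOf)
    (hHL : HoffsteinLuo1997_exists_twist_L_one_ne_zero)
    (hEd : edixhoven_optimalManinConstant_integral) (hMaz : mazur_not_dvd_maninConstant_of_odd)
    (hCassels : bsdRHS_eq_of_isIsogenous)
    (hHI : HeegnerIndexIdentity) (hB : TargetB) : TargetC := by
  intro W _ _ p _ hc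
  have hmod' := WeierstrassCurve.hasEntireLFunction_rat_of_exists_isNewformOf hnf
  have h0 : ∀ (W' : WeierstrassCurve ℚ) [W'.IsElliptic] [W'.IsGloballyMinimal],
      ClassX2 W' p → W'.analyticRank = 0 → BSDp W' p := by
    intro W' _ _ hX' hr'
    by_cases hgv : GVPar W' p
    · exact targetA_of_published hGV hWu hJs hJn hHs hHn hGZK hmod' hpar hGS W' p ⟨hr', hX', hgv⟩
    · exact hB W' p ⟨hr', hX', hgv⟩
  refine bsdp_of_cellC_of_forall_isIsogenous hEd hMaz hCassels hpar hnf hGZK W p hc ?_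
  intro W₀ _ _ _ hc₀ hMan₀
  exact bsdp_of_cellC_of_manin_of_partner hGZ hKo hHP hGZK hnf hHL twistTransportPackage_holds hHI W₀
    p hc₀ hMan₀
    (fun K _ _ hK _ _ _ hsplit _ Wd _ _ hWd hrd ↦
      pPartRankZero_twist_of_rankZero hmod' hGZK W₀ p hc₀.2 h0 K hK hsplit Wd hWd hrd)

/-- **What remains of class X2 in the kernel after gen 3 — no per-pair binder left**:
`X2.Target` follows from the PUBLISHED named facts (binders: Greenberg–Vatsal at `p ‖ N`
[flag `GV00-mult-asserted`], Wuthrich Thm. 16, Stein–Wuthrich Thm. 6.1/§4.2, Greenberg–Stevens,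
Gross–Zagier, Kolyvagin, GZK, modularity, Hoffstein–Luo, Edixhoven, Mazur 1978, Cassels) plus
EXACTLY two typed inputs: Mazur's main conjecture at every X2b pair (`MissingInputB`, exact by
`targetB_iff_forall_cellB_mazurMainConjectureAt`) and the Heegner-index identity over `K` at
`p ‖ N` (`HeegnerIndexIdentity`). [cite: Miller2011LMS, Def. 1.1 and §1] [cite: CastellaEtAl2021, Thm. 5.3.1]
[cite: Mazur1978, Cor. 4.1] -/
theorem target_of_published_of_missingInputB_of_heegnerIndexIdentity''
    (hGV : lambdaMu_multiplicative_of_gvPar) (hWu : thm16_charIdeal_dvd_multiplicative_of_reducible)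
    (hJs : thm61_splitMultiplicative) (hJn : thm61_nonsplitMultiplicative)
    (hHs : exists_isSplitMultCanonical) (hHn : exists_isMultCanonical)
    (hpar : nonempty_modularParametrizationData)
    (hGS : ∀ (W : WeierstrassCurve ℚ) [W.IsElliptic] [W.IsGloballyMinimal] (p : ℕ) [Fact p.Prime],
      greenberg_stevens (W := W) (p := p))
    (hGZ : ∀ (N : ℕ) [NeZero N] (W : WeierstrassCurve ℚ) (K : Type) [Field K] [NumberField K],
      gross_zagier N W K)
    (hKo : ∀ (N : ℕ) [NeZero N] (W : WeierstrassCurve ℚ) (K : Type) [Field K] [NumberField K],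
      kolyvagin N W K)
    (hHP : ∀ (N : ℕ) [NeZero N] (W : WeierstrassCurve ℚ) (K : Type) [Field K] [NumberField K],
      heegnerPointComplex_mem_range_map N W K)
    (hGZK : rank_eq_analyticRank_of_analyticRank_le_one) (hnf : exists_isNewformOf)
    (hHL : HoffsteinLuo1997_exists_twist_L_one_ne_zero)
    (hEd : edixhoven_optimalManinConstant_integral) (hMaz : mazur_not_dvd_maninConstant_of_odd)
    (hCassels : bsdRHS_eq_of_isIsogenous)
    (hmissB : ∀ (W : WeierstrassCurve ℚ) [W.IsElliptic] [W.IsGloballyMinimal] (p : ℕ) [Fact p.Prime],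
      CellB W p → MissingInputB W p)
    (hHI : HeegnerIndexIdentity) : Target :=
  have hmod' := WeierstrassCurve.hasEntireLFunction_rat_of_exists_isNewformOf hnf
  have hB : TargetB := targetB_of_missingInputB hJs hJn hHs hHn hGZK hmod' hpar hGS hmissB
  target_of_targets (targetA_of_published hGV hWu hJs hJn hHs hHn hGZK hmod' hpar hGS) hB
    (targetC_of_heegnerIndexIdentity_of_targetB hGV hWu hJs hJn hHs hHn hpar hGS hGZ hKo hHP hGZK
      hnf hHL hEd hMaz hCassels hHI hB)

end Summit.BirchSwinnertonDyer.Rank1Residual.X2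

end
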